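import Summits.BirchSwinnertonDyer.Rank1Residual.X11a.SelmerCompanionStrictCertificateAtP
import Summits.BirchSwinnertonDyer.Rank1Residual.X11a.SelmerCompanionStrictCertificateAway
import Literature.NumberTheory.EllipticCurves.OrdinaryLocalReductionMapProofs
import Literature.NumberTheory.EllipticCurves.FrobeniusEndomorphism
import Literature.NumberTheory.EllipticCurves.QuadraticTwistLFunctionProofs
import HarnessLib

/-!
# Route (3e) SELMER COMPANION, XXIII: the residue-field READING of the strictness certificates,
# in the kernel (class X11a = N7; cell `b2b-bsdres`, unit `b2b-bsdres-x11a`, gen 30)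

HONEST FRAMING (run/shared/lean/b2b/bsd-rank1-residual/, verbatim in every file): the goal of the
cell is to DELETE the COMBINATION-SHAPED residual classes of the Birch–Swinnerton-Dyer formula for
ALL analytic-rank `≤ 1` elliptic curves over `ℚ` — "full BSD formula for every rank `≤ 1` curve in
class `C`" assembled STRICTLY from published theorems — so that the rank-`≤ 1` remainder becomes
exactly the CONSTRUCTION-SHAPED classes, which are TYPED (missing-input `Prop`s), NOT attempted.
This is not "finishing BSD". CLASS-OWNERS.md: research routes; NO CLAIM BEYOND STATED CLASSES.
THEOREMS ONLY; nothing booked; no label moves.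

## What this file proves

Files XXI/XXII (gen 29) derive the strictness hypotheses of the booking shapes D / mirror / E from
the certificate on a rational point `g ∈ A(ℚ)` of the closed rank-one partner `A`, in the forms
(at `p`) `hcert`: *no `p`-th root `c ∈ A(K̄_p)` of `g` is rational modulo the kernel of reduction*,
and (away from `p`) *`g ∉ p·A(ℚ_{ℓ₀})`*. The census computes instead, in the finite group
`Ã(𝔽_ℓ)` of the reduction of the minimal model, that `(m/p)·g̃ ≠ O`, `m = #Ã(𝔽_ℓ)`. This file
proves that the residue-field computation implies both forms, through the tree's reduction map
`red₀ : A(K̄_v) → (A_ℤ ⊗ 𝒪_w mod 𝔪_w)(k̄_v)` of the minimal model (`OrdinaryLocalReductionMapProofs`,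
pinned down by `hred₀`; Silverman VII.2.1):

* `reductionPointCount_nsmul_localRed_eq_zero_of_forall_smul_sub_mem_kernel` — **a point of
  `A(K̄_v)` which is `Γ_{ℚ_v}`-invariant MODULO THE KERNEL OF REDUCTION has its reduction killed
  by `m = #Ã(𝔽_ℓ)`**: its reduction is fixed by an arithmetic Frobenius `τ ∈ Γ_{ℚ_v}`
  (`exists_isArithFrobAt_localAbsIntegers`), so its residue coordinates satisfy `x̄^ℓ = x̄`
  (`residueMap_pow_eq_of_reducePoint_smul_eq`), hence lie in `k_v = 𝔽_ℓ`
  (`mem_range_algebraMap_of_pow_card_eq`): the reduction is the image of a point of the finite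
  group `Ã(k_v)` of order `m` (`natCard_point_map_ringEquiv` along `k_v ≃ ℤ/ℓ`), killed by `m`;
* `nsmul_localRed_eq_zero_of_zsmul_eq` — hence if `g = p·c` in `A(K̄_v)` with such a `c` and
  `m = p·n`, then `n·g̃ = O`;
* `hcert_of_residue_certificate` — **at `p`**: `m = p·n` and `n·red₀(g) ≠ O` give the hypothesis
  `hcert` of file XXI verbatim;
* `not_zsmul_of_residue_certificate` — **away from `p`** (and at `p`): `m = p·n` and
  `n·red₀(g) ≠ O` give `g_v ≠ p·R` for every `R ∈ A(ℚ_v)` (`R` is `Γ_{ℚ_v}`-fixed in `A(K̄_v)`),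
  the hypothesis `hcert` of file XXII verbatim.

The booking corollaries with the residue certificate are in file XXIV. Binders: none new (the
reduction map and the local Frobenius are tree theorems). Not a class theorem; nothing booked.

References: [SilvermanAEC2009] VII.2.1, VII.§2; [GreenbergLNM1716] §2 p. 70 (`Ẽ(f)` finite);
[NeukirchANT1999] II (9.9); files XXI, XXII; HOME/b2b-bsdres-x11a/REPORT-g30.md.
-/

set_option autoImplicit false

noncomputable section

open scoped Classical NNReal

open WeierstrassCurve Literature.NumberTheory.EllipticCurves
  Literature.NumberTheory.GaloisRepresentations Field NumberField IsDedekindDomain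
  IsDedekindDomain.HeightOneSpectrum Literature.NumberTheory.EllipticCurves.FormalGroupChart
  Literature.NumberTheory.EllipticCurves.Rank1Residual
  Literature.NumberTheory.EllipticCurves.Rank1Residual.Typed

namespace Summit.BirchSwinnertonDyer.Rank1Residual.X11a.SelmerCompanion

variable (A : WeierstrassCurve ℚ) [A.IsGloballyMinimal] {p : ℕ} [hp : Fact p.Prime]
  {v : HeightOneSpectrum (𝓞 ℚ)} (hpv : (p : 𝓞 ℚ) ∈ v.asIdeal)
  {w : Valuation (AlgebraicClosure (v.adicCompletion ℚ)) ℝ≥0}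
  (hw : ∀ x, (w x : ℝ) = spectralNorm (v.adicCompletion ℚ) (AlgebraicClosure (v.adicCompletion ℚ)) x)
  (hΔu : IsUnit ((integralModelInt A).map (algebraMap ℤ ↥w.valuationSubring)).Δ)
  (red₀ : localPoints A (v.adicCompletion ℚ) →+
    (((integralModelInt A).map (algebraMap ℤ ↥w.valuationSubring)).map
      (IsLocalRing.residue ↥w.valuationSubring)).toAffine.Point)
  (hred₀ : ∀ P : localPoints A (v.adicCompletion ℚ), red₀ P =
    ((integralModelInt A).map (algebraMap ℤ ↥w.valuationSubring)).reducePoint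
      (Affine.Point.congrEquiv (localIntModel_baseChange A w.valuationSubring).symm P))

/-! ## §1 The reduction modulo `v` of the minimal model has `#Ã(𝔽_ℓ)` points over `k_v` -/

include hpv in
/-- `#(A_ℤ ⊗ k_v)(k_v) = reductionPointCount A p` for the place `v ∋ p` of `ℚ`: the residue field
`k_v` of `ℤ_v` is `ℤ/p` compatibly with the integers (`exists_residueField_ringEquiv_zmod`), and the
number of points is invariant under a ring isomorphism (`natCard_point_map_ringEquiv`). [folklore] -/
theorem natCard_point_integralModelInt_residueField_eq_reductionPointCount :
    Nat.card ((integralModelInt A).map (algebraMap ℤ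
      (IsLocalRing.ResidueField (v.adicCompletionIntegers ℚ)))).toAffine.Point =
      reductionPointCount A p := by
  obtain ⟨e, he⟩ := exists_residueField_ringEquiv_zmod v
  have hvp : (Rat.HeightOneSpectrum.primesEquiv v : ℕ) = p :=
    Rat.HeightOneSpectrum.primesEquiv_eq_of_natCast_mem v hp.out hpv
  let e' : IsLocalRing.ResidueField (v.adicCompletionIntegers ℚ) ≃+* ZMod p :=
    e.trans (ZMod.ringEquivCongr hvp)
  rw [← natCard_point_map_ringEquiv e', WeierstrassCurve.map_map, reductionPointCount_eq_natCard_point]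
  exact congrArg (fun f : ℤ →+* ZMod p ↦ Nat.card ((integralModelInt A).map f).toAffine.Point)
    (RingHom.ext_int _ _)

/-! ## §2 Reductions invariant under `Γ_{ℚ_v}` are killed by `#Ã(𝔽_ℓ)` -/

include hpv hw hΔu hred₀ in
/-- **A point of `A(K̄_v)` whose reduction is fixed by an arithmetic Frobenius has reduction killed
by `m = #Ã(𝔽_ℓ)`.** For the place `v ∋ p` of `ℚ`, the spectral valuation `w` of `K̄_v`, the
reduction map `red₀` of the minimal model `A_ℤ ⊗ 𝒪_w` (unit discriminant, `hΔu`) and an arithmetic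
Frobenius `τ ∈ Γ_{ℚ_v}` at a prime `𝔐` of `\bar ℤ_v`: if `red₀ (τc) = red₀ c` then
`reductionPointCount A p • red₀ c = 0`. PROOF: for `c = (x, y)` integral, the residues of `x, y`
in `k̄_v` satisfy `x̄^p = x̄` (`residueMap_pow_eq_of_reducePoint_smul_eq`), so lie in `k_v`
(`mem_range_algebraMap_of_pow_card_eq`); hence `red₀ c` is the image of a point of
`(A_ℤ ⊗ k_v)(k_v)`, a group of order `reductionPointCount A p` (§1), under the homomorphism
`mapPointHom` along `k_v → 𝒪_w/𝔪_w`. Greenberg, LNM 1716, §2 p. 70 ("`Ẽ(f)` is finite");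
Silverman, *AEC*, VII.2.1. [cite: GreenbergLNM1716, §2 p. 70] [cite: SilvermanAEC2009, Prop. VII.2.1] -/
theorem reductionPointCount_nsmul_localRed_eq_zero_of_frobenius
    {𝔐 : Ideal v.localAbsIntegers} (h𝔐 : 𝔐 ∈ v.localPrimesAbove)
    {τ : absoluteGaloisGroup (v.adicCompletion ℚ)}
    (hτ : IsArithFrobAt (v.adicCompletionIntegers ℚ) τ 𝔐)
    (c : localPoints A (v.adicCompletion ℚ)) (hc : red₀ (τ • c) = red₀ c) :
    reductionPointCount A p • red₀ c = 0 := by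
  have hvO : w.Integers w.valuationSubring := Valuation.valuationSubring.integers w
  haveI : Finite (IsLocalRing.ResidueField (v.adicCompletionIntegers ℚ)) :=
    finite_residueField_adicCompletionIntegers ℚ v
  have hMK := localIntModel_baseChange A w.valuationSubring
  -- `q = p`
  have hq : Nat.card (IsLocalRing.ResidueField (v.adicCompletionIntegers ℚ)) = p := by
    rw [WeierstrassCurve.natCard_residueField_adicCompletionIntegers v,
      Rat.HeightOneSpectrum.primesEquiv_eq_of_natCast_mem v hp.out hpv]
  -- the residue map `r : 𝒪_w → k̄_v` and the structure map `ι : ℤ_v → 𝒪_w`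
  obtain ⟨r, hr, hrO, hrF⟩ := exists_residueMap (v := v) hw h𝔐
  obtain ⟨ι, hι⟩ := exists_ringHom_adicCompletionIntegers_integer (v := v) hw
  let ι' : v.adicCompletionIntegers ℚ →+* ↥w.valuationSubring := ι
  haveI hloc : IsLocalHom ι' := isLocalHom_of_coe_eq hw hι
  let f : IsLocalRing.ResidueField (v.adicCompletionIntegers ℚ) →+*
      IsLocalRing.ResidueField ↥w.valuationSubring :=
    IsLocalRing.ResidueField.map ι'
  -- the model over `k_v`; its base change along `f` is the reduction of `A_ℤ ⊗ 𝒪_w`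
  have hred : ((integralModelInt A).map
      (algebraMap ℤ (IsLocalRing.ResidueField (v.adicCompletionIntegers ℚ)))).map f =
      ((integralModelInt A).map (algebraMap ℤ ↥w.valuationSubring)).map
        (IsLocalRing.residue ↥w.valuationSubring) := by
    rw [WeierstrassCurve.map_map, WeierstrassCurve.map_map]
    congr 1
    exact RingHom.ext_int _ _
  have hcardMv := natCard_point_integralModelInt_residueField_eq_reductionPointCount A hpv
  -- the transported Frobenius congruence
  have heq : ((integralModelInt A).map (algebraMap ℤ ↥w.valuationSubring)).reducePoint
      (Affine.Point.congrEquiv hMK.symm (τ • c)) =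
      ((integralModelInt A).map (algebraMap ℤ ↥w.valuationSubring)).reducePoint
      (Affine.Point.congrEquiv hMK.symm c) := by
    rw [← hred₀, ← hred₀]; exact hc
  -- case analysis on `c`
  change (A.baseChange (AlgebraicClosure (v.adicCompletion ℚ))).toAffine.Point at c
  rcases c with _ | ⟨x, y, h⟩
  · exact (congrArg (reductionPointCount A p • ·) (map_zero red₀)).trans (nsmul_zero _)
  by_cases hx : w x ≤ 1
  swap
  · -- `c ∈ A₁`: `red₀ c = 0`
    have h0 : red₀ (Affine.Point.some x y h) = 0 := by
      rw [hred₀]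
      change goodReductionHom _ hvO hΔu _ = 0
      rw [goodReductionHom_eq_zero_iff, Affine.Point.congrEquiv_some, reducesToZero_some_iff,
        not_mem_range_iff hvO]
      exact not_le.mp hx
    rw [h0, nsmul_zero]
  -- `c = (x, y)` integral: Frobenius-fixed residues
  obtain ⟨hy, hxq, hyq⟩ := residueMap_pow_eq_of_reducePoint_smul_eq hw hr hrF hτ hΔu hMK hx rfl heq
  rw [hq] at hxq hyq
  obtain ⟨hy', hns, e⟩ := reducePoint_congrEquiv_some_of_val_le_one hΔu hMK x y h hx
  have hredc : red₀ (Affine.Point.some x y h) =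
      .some (IsLocalRing.residue ↥w.valuationSubring ⟨x, hx⟩)
        (IsLocalRing.residue ↥w.valuationSubring ⟨y, hy'⟩) hns := by
    rw [hred₀]; exact e
  -- the residues lie in `k_v`
  have key : ∀ (z : AlgebraicClosure (v.adicCompletion ℚ)) (hz : w z ≤ 1),
      r ⟨z, hz⟩ ^ p = r ⟨z, hz⟩ →
      ∃ a : IsLocalRing.ResidueField (v.adicCompletionIntegers ℚ),
        f a = IsLocalRing.residue ↥w.valuationSubring ⟨z, hz⟩ := by
    intro z hz hzq
    rw [← hq] at hzq
    obtain ⟨a, ha⟩ := WeierstrassCurve.mem_range_algebraMap_of_pow_card_eq hzq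
    obtain ⟨t, rfl⟩ := IsLocalRing.residue_surjective a
    refine ⟨IsLocalRing.residue _ t, ?_⟩
    change IsLocalRing.ResidueField.map ι' (IsLocalRing.residue _ t) = _
    rw [IsLocalRing.ResidueField.map_residue]
    -- `residue_w (ι t) = residue_w z` iff `w (ι t - z) < 1` iff `r (ι t) = r z`
    have hιt : w ((ι t : w.integer) : AlgebraicClosure (v.adicCompletion ℚ)) ≤ 1 := (ι t).2
    have hmem : w (algebraMap (v.adicCompletion ℚ) (AlgebraicClosure (v.adicCompletion ℚ))
        (algebraMap (v.adicCompletionIntegers ℚ) (v.adicCompletion ℚ) t)) ≤ 1 := by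
      have h := hιt
      rw [hι t] at h
      exact h
    have hrιt : r (ι t) = algebraMap (IsLocalRing.ResidueField (v.adicCompletionIntegers ℚ)) _
        (IsLocalRing.residue _ t) := by
      have h1 : ι t = ⟨_, hmem⟩ := Subtype.ext (hι t)
      rw [h1]
      exact hrO t hmem
    have hsub : r (ι t - ⟨z, hz⟩) = 0 := by rw [map_sub, hrιt, ha, sub_self]
    rw [hr] at hsub
    apply Ideal.Quotient.eq.mpr
    rw [IsLocalRing.mem_maximalIdeal, mem_nonunits_iff, hvO.isUnit_iff_valuation_eq_one]
    exact ne_of_lt hsub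
  obtain ⟨a, ha⟩ := key x hx hxq
  obtain ⟨b, hb⟩ := key y hy' hyq
  -- the point `(a, b)` of `(A_ℤ ⊗ k_v)(k_v)` maps to `red₀ c`
  have hns' : (((integralModelInt A).map
      (algebraMap ℤ (IsLocalRing.ResidueField (v.adicCompletionIntegers ℚ)))).map f).toAffine.Nonsingular
      (f a) (f b) := by
    rw [hred, ha, hb]; exact hns
  have hab : ((integralModelInt A).map
      (algebraMap ℤ (IsLocalRing.ResidueField (v.adicCompletionIntegers ℚ)))).toAffine.Nonsingular a b :=
    (Affine.map_nonsingular _ f.injective a b).mp hns'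
  have himg : Affine.Point.congrEquiv hred (mapPointHom _ f (.some a b hab)) =
      red₀ (Affine.Point.some x y h) := by
    rw [mapPointHom_some, Affine.Point.congrEquiv_some, hredc]
    simp only [Affine.Point.some.injEq]
    exact ⟨ha, hb⟩
  rw [← himg, ← map_nsmul, ← map_nsmul, ← hcardMv, card_nsmul_eq_zero', map_zero, map_zero]

include hpv hw hΔu hred₀ in
/-- **A point of `A(K̄_v)` which is `Γ_{ℚ_v}`-invariant modulo the kernel of reduction `A₁` has
reduction killed by `m = #Ã(𝔽_ℓ)`**: if `σc − c ∈ A₁(K̄_v)` for all `σ ∈ Γ_{ℚ_v}` then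
`reductionPointCount A p • red₀ c = 0` (take `σ` an arithmetic Frobenius,
`exists_isArithFrobAt_localAbsIntegers`; `A₁ = ker red₀`, `localRed_eq_zero_iff_mem_kernel`).
In particular this applies to every `ℚ_v`-RATIONAL point (`σc = c`): "`A(ℚ_v)/A₁(ℚ_v) ↪ Ã(𝔽_ℓ)`",
Silverman, *AEC*, VII.2.1. [cite: SilvermanAEC2009, Prop. VII.2.1] [cite: GreenbergLNM1716, §2 p. 70] -/
theorem reductionPointCount_nsmul_localRed_eq_zero_of_forall_smul_sub_mem_kernel
    [hV : (A.baseChange (AlgebraicClosure (v.adicCompletion ℚ))).IsIntegral w.integer]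
    (c : localPoints A (v.adicCompletion ℚ))
    (hc : ∀ σ : absoluteGaloisGroup (v.adicCompletion ℚ),
      ((σ • c - c : localPoints A (v.adicCompletion ℚ)) :
        (A.baseChange (AlgebraicClosure (v.adicCompletion ℚ))).toAffine.Point) ∈
        kernel w (A.baseChange (AlgebraicClosure (v.adicCompletion ℚ)))) :
    reductionPointCount A p • red₀ c = 0 := by
  obtain ⟨𝔐, h𝔐⟩ := v.localPrimesAbove_nonempty
  obtain ⟨τ, hτ⟩ := exists_isArithFrobAt_localAbsIntegers v h𝔐
  refine reductionPointCount_nsmul_localRed_eq_zero_of_frobenius A hpv hw hΔu red₀ hred₀ h𝔐 hτ c ?_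
  have h0 : red₀ (τ • c - c) = 0 :=
    (A.localRed_eq_zero_iff_mem_kernel hΔu red₀ hred₀ (τ • c - c)).mpr (hc τ)
  rwa [map_sub, sub_eq_zero] at h0

include hpv hw hΔu hred₀ in
/-- **`n·g̃ = O` for a `p`-divisible point.** If `g = p·c` in `A(K̄_v)` with `c` invariant under
`Γ_{ℚ_v}` modulo `A₁`, and `#Ã(𝔽_ℓ) = p·n`, then `n • red₀ g = 0` (`red₀ g = p • red₀ c` and
`(p·n) • red₀ c = 0`). [cite: SilvermanAEC2009, Prop. VII.2.1] -/
theorem nsmul_localRed_eq_zero_of_zsmul_eq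
    [hV : (A.baseChange (AlgebraicClosure (v.adicCompletion ℚ))).IsIntegral w.integer]
    {n : ℕ} (hn : reductionPointCount A p = p * n)
    {g c : localPoints A (v.adicCompletion ℚ)} (hgc : (p : ℤ) • c = g)
    (hc : ∀ σ : absoluteGaloisGroup (v.adicCompletion ℚ),
      ((σ • c - c : localPoints A (v.adicCompletion ℚ)) :
        (A.baseChange (AlgebraicClosure (v.adicCompletion ℚ))).toAffine.Point) ∈
        kernel w (A.baseChange (AlgebraicClosure (v.adicCompletion ℚ)))) :
    n • red₀ g = 0 := by
  have h := reductionPointCount_nsmul_localRed_eq_zero_of_forall_smul_sub_mem_kernel A hpv hw hΔu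
    red₀ hred₀ c hc
  rw [hn, mul_nsmul] at h
  rwa [← hgc, map_zsmul, natCast_zsmul]

/-! ## §3 The certificate at `p` (file XXI's `hcert`) from the residue field -/

include hpv hw hΔu hred₀ in
/-- **The strictness certificate at `p`, residue-field form.** Let `v ∋ p` with `A` good at `p`
(`hΔu`), `g ∈ A(K̄_v)` (the image of a rational point), `#Ã(𝔽_p) = p·n` and `n • red₀ g ≠ 0`
— the census check `(m/p)·g̃ ≠ O in Ã(𝔽_p)`. Then NO `p`-th root `c ∈ A(K̄_v)` of `g` is rational
modulo the kernel of reduction: for every `c` with `p c = g` some `σ ∈ Γ_{ℚ_v}` has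
`σc − c ∉ A₁(K̄_v)` — the hypothesis `hcert` of `strict_at_p_of_kummerClass` /
`bsdp_of_bsdp_partner_of_generator_certificate_at_p` (file XXI) verbatim. (No Hensel lemma is
needed in this direction: a root rational modulo `A₁` has `𝔽_p`-rational reduction `c̃` with
`p·c̃ = g̃`, so `(m/p)·g̃ = m·c̃ = O`.) [cite: SilvermanAEC2009, Prop. VII.2.1]
[cite: GreenbergLNM1716, §2 p. 70] -/
theorem hcert_of_residue_certificate
    [hV : (A.baseChange (AlgebraicClosure (v.adicCompletion ℚ))).IsIntegral w.integer]
    {n : ℕ} (hn : reductionPointCount A p = p * n)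
    {g : localPoints A (v.adicCompletion ℚ)} (hg : n • red₀ g ≠ 0) :
    ∀ c : localPoints A (v.adicCompletion ℚ), (p : ℤ) • c = g →
      ∃ σ : absoluteGaloisGroup (v.adicCompletion ℚ),
        ((σ • c - c : localPoints A (v.adicCompletion ℚ)) :
          (A.baseChange (AlgebraicClosure (v.adicCompletion ℚ))).toAffine.Point) ∉
          kernel w (A.baseChange (AlgebraicClosure (v.adicCompletion ℚ))) := by
  intro c hc
  by_contra hall
  push Not at hall
  exact hg (nsmul_localRed_eq_zero_of_zsmul_eq A hpv hw hΔu red₀ hred₀ hn hc hall)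

/-! ## §4 The certificate away from `p` (file XXII's `hcert`) from the residue field -/

include hpv hw hΔu hred₀ in
/-- **`g ∉ p·A(ℚ_v)` from the residue field.** Let `v ∋ ℓ` (here named `p`; any prime where the
minimal model of `A` has unit discriminant, `hΔu`), `g ∈ A(ℚ)`, `#Ã(𝔽_ℓ) = ℓ' · n` for the descent
prime `ℓ'` (named `q`) and `n • red₀ g ≠ 0` for the image of `g` in `A(K̄_v)` — the census check
`(m/q)·g̃ ≠ O in Ã(𝔽_ℓ)`. Then the image of `g` in `A(ℚ_v)` is not `q` times a `ℚ_v`-rational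
point — the hypothesis `hcert` of `strict_away_of_generator_certificate` /
`bsdp_of_bsdp_partner_of_generator_certificate_away` (file XXII) verbatim: a `ℚ_v`-rational `R`
is `Γ_{ℚ_v}`-fixed in `A(K̄_v)` (`smul_toGeomPoints`, `baseChangeGeomPointsEquiv_smul`), so
`m • red₀ R = 0`, while `red₀ g = q • red₀ R`
(`baseChangeGeomPointsEquiv_toGeomPoints_baseChange`: the image of `g_v` in `A(K̄_v)` is
`pointsMap (toGeomPoints g)`). [cite: SilvermanAEC2009, Prop. VII.2.1] -/
theorem not_zsmul_of_residue_certificate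
    [hV : (A.baseChange (AlgebraicClosure (v.adicCompletion ℚ))).IsIntegral w.integer]
    {q n : ℕ} (hn : reductionPointCount A p = q * n) (g : A.toAffine.Point)
    (hg : n • red₀ (pointsMap A (v.adicCompletion ℚ) (toGeomPoints A g)) ≠ 0) :
    ∀ R : (A.baseChange (v.adicCompletion ℚ)).toAffine.Point,
      Affine.Point.baseChange (W' := A) ℚ (v.adicCompletion ℚ) g ≠ (q : ℤ) • R := by
  intro R hR
  apply hg
  -- `R` read in `A(K̄_v)`, `Γ_{ℚ_v}`-fixed
  set c : localPoints A (v.adicCompletion ℚ) :=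
    A.baseChangeGeomPointsEquiv (v.adicCompletion ℚ)
      (toGeomPoints (A.baseChange (v.adicCompletion ℚ)) R) with hcdef
  have hcfix : ∀ σ : absoluteGaloisGroup (v.adicCompletion ℚ), σ • c = c := fun σ ↦ by
    rw [hcdef, ← baseChangeGeomPointsEquiv_smul, smul_toGeomPoints]
  have hgc : (q : ℤ) • c = pointsMap A (v.adicCompletion ℚ) (toGeomPoints A g) := by
    rw [hcdef, ← map_zsmul, ← map_zsmul, ← hR]
    exact X11b.KummerIndex.baseChangeGeomPointsEquiv_toGeomPoints_baseChange A
      (v.adicCompletion ℚ) g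
  have h := reductionPointCount_nsmul_localRed_eq_zero_of_forall_smul_sub_mem_kernel A hpv hw hΔu
    red₀ hred₀ c (fun σ ↦ by rw [hcfix σ, sub_self]; exact (kernel w _).zero_mem)
  rw [hn, mul_nsmul] at h
  rwa [← hgc, map_zsmul, natCast_zsmul]

end Summit.BirchSwinnertonDyer.Rank1Residual.X11a.SelmerCompanion

end
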